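import Summits.QuantumFields.BalabanUV.Beta.SymCorrectorFaceWeight
import Summits.QuantumFields.BalabanUV.Beta.BondIndicatorGaugeL1
import Summits.QuantumFields.BalabanUV.Beta.D1BFx.DshFaceMass
import Summits.QuantumFields.BalabanUV.Beta.CompositeCorrectorBordered

/-!
# `BalabanUV.Beta.D1BFx.FaceWeightMasses` — road «BF-x», binder row D1, PART 24-hyb HEAD rows (ms) ∕ (lamf) in MASS currency (leaf-03 g33, TT30): **THE FACE WEIGHT's BLOCK
# MASSES AT THE CENTRED ROOT — TOTAL `≤ (d+1)·(n·(d+1))`, FACE LAYER `≤ |box|⁻¹·2(d+1)²n^{d+1}`, INTERIOR `≤` TOTAL** — the record inputs `Bi`∕`Bf` of TT29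
# `SymCorrectorFaceWeightSplit.abs_faceWeight_le_mass_split` (the OWNER d1-p2 g25's WANTED O-6, W-g25-8 (c)) and the `faceWtSum ≤ 16n` of TT28's (ms) row.

WHY (my N-1 PS l.54904; the OWNER W-g25-8 (a): «with leaf-01's `DshFaceMass.sum_faces_abs_lam04_le` the face-layer mass of the face weight is `O(1)`»).  The face weight
`faceWt (ctrOff (d+1) n) n α x = |box|⁻¹·ζ_S(e_{(α,x)})(blk x)` IS `|box|⁻¹·lam04 n α x (blk x)` DEFINITIONALLY (gan24-leaf-05 g58 `BondIndicatorGaugeL1`, `indR_eq_delta1`), so its block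
masses are an1's comb-weight masses divided by `|box| = n^{d+1}`: total `≤ (d+1)·n` per direction (g58 `sum_box_abs_zetaS_delta1_le`), FACE LAYER (sites of the block with an offset
coordinate in `{0, n−1}`) `≤ |box|⁻¹·2(d+1)²·n^{d+1} = 2(d+1)²` (leaf-01 g33's O-6′ `DshFaceMass.sum_faces_abs_lam04_le`, `3 ≤ n`) — ONE POWER OF `n` BELOW the total.
CONTENT (generic `d`): `faceWtSum_ctrOff_le` (`1 ≤ n`); `sum_blockSitesF_filter_eq_sum_box_filter` (TT25's box re-indexing under a filter); `off_block` (`off n (n•Y + b) = b`);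
`abs_smul_faceWt_block_eq` (the summand as `|ξ|·|box|⁻¹·|lam04 …|` at the block's sites); **`faceLayerMass_smul_faceWt_le`** (`3 ≤ n`:
`Σ_α Σ_{x ∈ block Y, ∃ i, off n x i ∈ {0, n−1}} |ξ·faceWt (ctrOff (d+1) n) n α x| ≤ |ξ|·(|box|⁻¹·(2(d+1)²n^{d+1}))`); **`interiorMass_smul_faceWt_le`** (the complementary part `≤ |ξ|·((d+1)·(n·(d+1)))`,
the whole block mass).  [folklore] finite-sum bookkeeping BY NAME; no definition, no `def … : Prop`, nothing cited, 0 sorry; prices NO (1.22) row.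

HONEST DEPENDENCY (cell records, verbatim): «continuum YM on T⁴ ⇐ BetaPertH ∧ nine spine estimates (0/9 proved); BetaPertH ⇐ (D1) ∧ (D4) ∧
CAP+tail; G-an2-4 gates asym, D1 and NE2/3/4.»  HONEST FRAMING (cell contract, verbatim): «discharging `BetaPertH` makes Bałaban's UV stability
UNCONDITIONAL — a real constructive-QFT result; it is NOT the continuum limit and NOT the Clay problem.»  0∕4 row-D1 binders (hW ∕ hR ∕ D1Tel ∕ D1Rep); (J1) ONE OPEN ROW; (K) NOT
closed; NOT D1, NEVER «G-an2-4 closed», NOT `BetaPertH`, NOT continuum, NOT Clay.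

ABSOLUTE RULE (cell charter, verbatim): «No internally-minted statement may enter as a cited fact. Every hypothesis is either kernel-proved in
this package or a verbatim quotation of a PUBLISHED theorem with page reference. The manuscript(s) under audit are NOT citable for their own
disputed steps — they are the thing under adjudication; programme-internal (2001/route/tribunal) claims are never citable.»

Unit `b2b-balaban-beta-d1-formalise-leaf-03` (gen 33), 2026-08-23.  No existing file touched.
-/

noncomputable section

namespace Summit.QuantumFields.BalabanUV.Beta.D1BFx.FaceWeightMasses

open Finset
open scoped BigOperators
open Literature.MathematicalPhysics.QuantumFieldTheory
open Literature.MathematicalPhysics.QuantumFieldTheory.Balaban1983to89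
open Literature.MathematicalPhysics.QuantumFieldTheory.Balaban1983to89.Beta
open AffineAveraging (Site box toSite)
open AveragingContours (blk off off_mem_box blk_add_off blk_block)
open AveragingContoursRooted (ctr ctrOff)
open AxialProjector (toSite_injective)
open Summit.QuantumFields.BalabanUV.Beta.CompositeCorrectorLocality (blockSitesF)
open Summit.QuantumFields.BalabanUV.Beta.CompositeCorrectorBordered (indR_eq_delta1)
open Summit.QuantumFields.BalabanUV.Beta.DshAn1 (lam04)
open Summit.QuantumFields.BalabanUV.Beta.SymCorrectorFace (faceWt faceWtSum)
open Summit.QuantumFields.BalabanUV.Beta.SymCorrectorFaceWeight (sum_blockSitesF_eq_sum_box blockMass_smul_faceWt_eq)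
open Summit.QuantumFields.BalabanUV.Beta.BondIndicatorGaugeL1 (sum_box_abs_zetaS_delta1_le)
open Summit.QuantumFields.BalabanUV.Beta.D1BFx.DshFaceMass (sum_faces_abs_lam04_le)

variable {d : ℕ} {n : ℕ}

/-! ## §1 The total block mass at the centred root -/

/-- [folklore] **THE FACE WEIGHT's BLOCK MASS AT THE CENTRED ROOT IS `≤ (d+1)·(n·(d+1))`** (gan24-leaf-05 g58's block-`ℓ¹` law `BondIndicatorGaugeL1.sum_box_abs_zetaS_delta1_le`
per direction at the block `0`, `indR = delta1`). -/
theorem faceWtSum_ctrOff_le (hn : 1 ≤ n) :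
    faceWtSum (ctrOff (d + 1) n) n ≤ ((d : ℝ) + 1) * ((n : ℝ) * ((d : ℝ) + 1)) := by
  unfold faceWtSum
  have h : ∀ α : Fin (d + 1), ∑ b ∈ box (d + 1) n, |faceWt (ctrOff (d + 1) n) n α (toSite b)| ≤ (n : ℝ) * ((d : ℝ) + 1) := by
    intro α
    have h58 := sum_box_abs_zetaS_delta1_le (d := d) hn α 0
    simp only [smul_zero, zero_add] at h58
    simpa only [faceWt, indR_eq_delta1] using h58
  calc ∑ α : Fin (d + 1), ∑ b ∈ box (d + 1) n, |faceWt (ctrOff (d + 1) n) n α (toSite b)|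
      ≤ ∑ _α : Fin (d + 1), (n : ℝ) * ((d : ℝ) + 1) := Finset.sum_le_sum fun α _ => h α
    _ = ((d : ℝ) + 1) * ((n : ℝ) * ((d : ℝ) + 1)) := by
        rw [Finset.sum_const, Finset.card_univ, Fintype.card_fin, nsmul_eq_mul]; push_cast; ring

/-! ## §2 Re-indexing a filtered block sum by the box; offsets of block points -/

/-- [folklore] **A FILTERED BLOCK SUM RE-INDEXED BY THE BOX**: `Σ_{x ∈ blockSitesF n Y, P x} f x = Σ_{b ∈ box, P (n•Y + b)} f (n•Y + b)` (TT25's `sum_blockSitesF_eq_sum_box` under `Finset.sum_filter`). -/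
theorem sum_blockSitesF_filter_eq_sum_box_filter (hn : 0 < n) (P : Site (d + 1) → Prop) [DecidablePred P] (f : Site (d + 1) → ℝ) (Y : Site (d + 1)) :
    ∑ x ∈ (blockSitesF n Y).filter P, f x = ∑ b ∈ (box (d + 1) n).filter (fun b => P ((n : ℤ) • Y + toSite b)), f ((n : ℤ) • Y + toSite b) := by
  rw [Finset.sum_filter, Finset.sum_filter, sum_blockSitesF_eq_sum_box hn]

/-- [folklore] The offset of the block point `n•Y + b` (`b ∈ box`) is `b`. -/
theorem off_block (hn : 1 ≤ n) (Y : Site (d + 1)) {b : Fin (d + 1) → ℕ} (hb : b ∈ box (d + 1) n) : off n ((n : ℤ) • Y + toSite b) = b := by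
  apply toSite_injective
  have h := blk_add_off hn ((n : ℤ) • Y + toSite b)
  rw [blk_block Y hb] at h
  exact add_left_cancel h

/-- [folklore] **THE SUMMAND AT A BLOCK POINT**: `|ξ·faceWt (ctrOff (d+1) n) n α (n•Y + b)| = |ξ|·(|box|⁻¹·|lam04 n α (n•Y + b) Y|)` (`faceWt = |box|⁻¹·ζ_S(indR)(blk)`,
`indR = delta1`, `ζ_S ρ_c n (delta1 α x) = lam04 n α x` definitionally, `blk n (n•Y + b) = Y`). -/
theorem abs_smul_faceWt_block_eq (ξ : ℝ) (α : Fin (d + 1)) (Y : Site (d + 1)) {b : Fin (d + 1) → ℕ} (hb : b ∈ box (d + 1) n) :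
    |ξ * faceWt (ctrOff (d + 1) n) n α ((n : ℤ) • Y + toSite b)|
      = |ξ| * ((((box (d + 1) n).card : ℝ))⁻¹ * |lam04 n α ((n : ℤ) • Y + toSite b) Y|) := by
  have e : faceWt (ctrOff (d + 1) n) n α ((n : ℤ) • Y + toSite b)
      = (((box (d + 1) n).card : ℝ))⁻¹ * lam04 n α ((n : ℤ) • Y + toSite b) Y := by
    rw [faceWt, indR_eq_delta1, blk_block Y hb]
    rfl
  rw [abs_mul, e, abs_mul, abs_inv, Nat.abs_cast]

/-! ## §3 The face layer and the interior -/

/-- [folklore] **THE FACE-LAYER BLOCK MASS OF THE FACE WEIGHT IS `O(1)`** (`3 ≤ n`): at every block `Y` and scalar `ξ`,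
`Σ_α Σ_{x ∈ blockSitesF n Y, ∃ i, off n x i = 0 ∨ off n x i = n − 1} |ξ·faceWt (ctrOff (d+1) n) n α x| ≤ |ξ|·(|box|⁻¹·(2·(d+1)²·n^{d+1}))` — leaf-01 g33's
`DshFaceMass.sum_faces_abs_lam04_le` after §2 (ONE POWER of `n` below the total `(d+1)·(n·(d+1))`). -/
theorem faceLayerMass_smul_faceWt_le (hn3 : 3 ≤ n) (ξ : ℝ) (Y : Site (d + 1)) :
    ∑ α : Fin (d + 1), ∑ x ∈ (blockSitesF n Y).filter (fun x => ∃ i, off n x i = 0 ∨ off n x i = n - 1), |ξ * faceWt (ctrOff (d + 1) n) n α x|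
      ≤ |ξ| * ((((box (d + 1) n).card : ℝ))⁻¹ * (2 * ((d : ℝ) + 1) ^ 2 * (n : ℝ) ^ (d + 1))) := by
  have hn1 : 1 ≤ n := le_trans (by norm_num) hn3
  have hn0 : 0 < n := hn1
  -- re-index every direction's filtered block sum by the box; the predicate reads the offset `b`
  have hre : ∀ α : Fin (d + 1),
      ∑ x ∈ (blockSitesF n Y).filter (fun x => ∃ i, off n x i = 0 ∨ off n x i = n - 1), |ξ * faceWt (ctrOff (d + 1) n) n α x|
        = ∑ b ∈ (box (d + 1) n).filter (fun b' => ∃ i, b' i = 0 ∨ b' i = n - 1),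
            |ξ| * ((((box (d + 1) n).card : ℝ))⁻¹ * |lam04 n α ((n : ℤ) • Y + toSite b) Y|) := by
    intro α
    rw [sum_blockSitesF_filter_eq_sum_box_filter hn0]
    have hfilt : (box (d + 1) n).filter (fun b => ∃ i, off n ((n : ℤ) • Y + toSite b) i = 0 ∨ off n ((n : ℤ) • Y + toSite b) i = n - 1)
        = (box (d + 1) n).filter (fun b' => ∃ i, b' i = 0 ∨ b' i = n - 1) :=
      Finset.filter_congr fun b hb => by rw [off_block hn1 Y hb]
    rw [hfilt]
    exact Finset.sum_congr rfl fun b hb => abs_smul_faceWt_block_eq ξ α Y (Finset.mem_filter.1 hb).1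
  have hbox : 0 ≤ (((box (d + 1) n).card : ℝ))⁻¹ := inv_nonneg.2 (Nat.cast_nonneg _)
  calc ∑ α : Fin (d + 1), ∑ x ∈ (blockSitesF n Y).filter (fun x => ∃ i, off n x i = 0 ∨ off n x i = n - 1), |ξ * faceWt (ctrOff (d + 1) n) n α x|
      = ∑ α : Fin (d + 1), ∑ b ∈ (box (d + 1) n).filter (fun b' => ∃ i, b' i = 0 ∨ b' i = n - 1),
            |ξ| * ((((box (d + 1) n).card : ℝ))⁻¹ * |lam04 n α ((n : ℤ) • Y + toSite b) Y|) := Finset.sum_congr rfl fun α _ => hre α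
    _ = |ξ| * ((((box (d + 1) n).card : ℝ))⁻¹
            * ∑ α : Fin (d + 1), ∑ b ∈ (box (d + 1) n).filter (fun b' => ∃ i, b' i = 0 ∨ b' i = n - 1), |lam04 n α ((n : ℤ) • Y + toSite b) Y|) := by
        rw [Finset.mul_sum, Finset.mul_sum]
        refine Finset.sum_congr rfl fun α _ => ?_
        rw [Finset.mul_sum, Finset.mul_sum]
    _ ≤ |ξ| * ((((box (d + 1) n).card : ℝ))⁻¹ * (2 * ((d : ℝ) + 1) ^ 2 * (n : ℝ) ^ (d + 1))) :=
        mul_le_mul_of_nonneg_left (mul_le_mul_of_nonneg_left (sum_faces_abs_lam04_le hn3 Y) hbox) (abs_nonneg ξ)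

/-- [folklore] **THE INTERIOR BLOCK MASS IS AT MOST THE TOTAL**: for every decidable site predicate `P`, block `Y` and scalar `ξ`,
`Σ_α Σ_{x ∈ blockSitesF n Y, ¬P x} |ξ·faceWt (ctrOff (d+1) n) n α x| ≤ |ξ|·((d+1)·(n·(d+1)))` (`1 ≤ n`; TT25's `blockMass_smul_faceWt_eq` + §1). -/
theorem interiorMass_smul_faceWt_le (hn : 1 ≤ n) (P : Site (d + 1) → Prop) [DecidablePred P] (ξ : ℝ) (Y : Site (d + 1)) :
    ∑ α : Fin (d + 1), ∑ x ∈ (blockSitesF n Y).filter (fun x => ¬ P x), |ξ * faceWt (ctrOff (d + 1) n) n α x|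
      ≤ |ξ| * (((d : ℝ) + 1) * ((n : ℝ) * ((d : ℝ) + 1))) := by
  have hn0 : 0 < n := hn
  calc ∑ α : Fin (d + 1), ∑ x ∈ (blockSitesF n Y).filter (fun x => ¬ P x), |ξ * faceWt (ctrOff (d + 1) n) n α x|
      ≤ ∑ α : Fin (d + 1), ∑ x ∈ blockSitesF n Y, |ξ * faceWt (ctrOff (d + 1) n) n α x| :=
        Finset.sum_le_sum fun α _ => Finset.sum_le_sum_of_subset_of_nonneg (Finset.filter_subset _ _) (fun _ _ _ => abs_nonneg _)
    _ = |ξ| * faceWtSum (ctrOff (d + 1) n) n := blockMass_smul_faceWt_eq hn0 (ctrOff (d + 1) n) ξ Y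
    _ ≤ |ξ| * (((d : ℝ) + 1) * ((n : ℝ) * ((d : ℝ) + 1))) := mul_le_mul_of_nonneg_left (faceWtSum_ctrOff_le hn) (abs_nonneg ξ)

/-- [folklore] The face-layer part at every block, in the same shape as TT29's `hcf` (the face predicate spelled on sites through `off`). -/
theorem faceMass_smul_faceWt_le (hn3 : 3 ≤ n) (ξ : ℝ) :
    ∀ Y : Site (d + 1), ∑ α : Fin (d + 1), ∑ x ∈ (blockSitesF n Y).filter (fun x => ∃ i, off n x i = 0 ∨ off n x i = n - 1),
        |ξ * faceWt (ctrOff (d + 1) n) n α x| ≤ |ξ| * ((((box (d + 1) n).card : ℝ))⁻¹ * (2 * ((d : ℝ) + 1) ^ 2 * (n : ℝ) ^ (d + 1))) :=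
  fun Y => faceLayerMass_smul_faceWt_le hn3 ξ Y

end Summit.QuantumFields.BalabanUV.Beta.D1BFx.FaceWeightMasses

end
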